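import Summits.KontsevichZagierPeriods.Zeta5Search.Barrier.ConeGammaFarSliceSound

/-!
# ζ(5) search — BARRIER: `C₀` TO FIRST ORDER IN THE FAR CHART — soundness Ib: point enclosures at the centre

HONEST FRAMING (cell `pub-zeta5`): systematic search; no irrationality claim unless kernel-certified. Theorems only. MODEL
objects under Brown–Zudilin's (28)+(30) ((28) observed, not proved): the resolved `Y`-part `H` of cert-2 g39's value function in
cert-2 g38's far chart and the `Y`-free part `A` (`FarSlice.valH`, `valA`) at the CENTRE direction of a box and the fixed
abscissa `X_c`, enclosed by the checker's `xlnxI`, `hAt`, `etaAt`, `aCentre` (`ConeGammaFarSliceCheck`; the tree's `MI.logNat2`).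
Nothing here is a statement about the size of any critical value of record, any γ, the cone's supremum (C2 OPEN), S-E
(CONJECTURED), (TD_A) or `ζ(5)`; no number of record moves; records in print UNMOVED. Theory seat cert-2 g40 (item «C₀ TO FIRST
ORDER IN THE FAR CHART — THE CENTRE-SLICE CERTIFICATE», part 3a′).

* `xlnxI_sound` — `xlnx(w/N) ∈ xlnxI w N`; `mval_centre`, `kval_centre` — the resolved forms at the centre are `wAt/(Q·zden)`;
* `hAt_sound`, `etaAt_sound` — `H(c, X_c, zN/zden)` and the log-form of `H′` there; `aCentre_sound` — `A(c, X_c)`.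
-/

open Finset Set
open Literature.Analysis.ValidatedNumerics.NumericsMP

namespace Summit.KontsevichZagierPeriods.Zeta5Search.Barrier.ConeGamma

namespace FarSlice

open LemmaFBox (SC SC_pos coef featVal minNum maxNum box centre minNum_add_maxNum)
open Envelope (EForm formVal valF)

/-! ### Point enclosures: `xlnx`, `H`, `H′`'s log-form and `A` at the centre -/

/-- **`xlnxI w N ∋ xlnx (w/N)`** (`N > 0`). -/
theorem xlnxI_sound {w : ℤ} {N : ℕ} (hN : 0 < N) {I : MI} (h : xlnxI w N = some I) : MI.mem SC (xlnx ((w : ℝ) / N)) I := by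
  unfold xlnxI at h
  by_cases hw : w = 0
  · simp [hw] at h
  rw [if_neg hw] at h
  split at h
  swap
  · simp at h
  rename_i Lw LN hLw hLN
  simp only [Option.some.injEq] at h
  subst h
  have hNr : (0 : ℝ) < N := by exact_mod_cast hN
  have hwr : (w : ℝ) ≠ 0 := by exact_mod_cast hw
  -- log|w/N| = log|w| − log N
  have hlog : MI.mem SC (Real.log |(w : ℝ) / N|) (Lw.sub LN) := by
    have h1 := MI.mem_logNat2 SC_pos hLw
    have h2 := MI.mem_logNat2 SC_pos hLN
    have e : Real.log |(w : ℝ) / N| = Real.log (w.natAbs : ℕ) - Real.log N := by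
      rw [abs_div, abs_of_pos hNr, Real.log_div (abs_ne_zero.mpr hwr) hNr.ne']
      congr 1
      rw [Nat.cast_natAbs, Int.cast_abs]
    rw [e]; exact MI.mem_sub h1 h2
  have hv : MI.mem SC ((w : ℝ) / N) (MI.ofFrac SC w N) := MI.mem_ofFrac SC w hN
  have hmul := MI.mem_divNat (MI.mem_mulInt hlog w) hN
  have e : xlnx ((w : ℝ) / N) = Real.log |(w : ℝ) / N| * w / N - (w : ℝ) / N := by unfold xlnx; ring
  rw [e]
  exact MI.mem_sub hmul hv

/-- `m_k(c, X_c)·Q = mcN` at the box centre (`Q = 2·D·T`, `X_c = xc/Q`). -/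
theorem mval_centre {D T : ℕ} (hD : 0 < D) (hT : 0 < T) (lo hi : List ℕ) (xc : ℤ) (f : KForm) :
    mval f (centre D lo hi) ((xc : ℝ) / (2 * D * T)) * (2 * D * T) = (mcN T lo hi xc f : ℝ) := by
  have h := minNum_add_maxNum hD lo hi f.al
  have hQ : (2 * (D : ℝ) * T) ≠ 0 := by positivity
  unfold mval mcN
  push_cast
  have e : (featVal f.al (centre D lo hi) + (f.bx : ℝ) * ((xc : ℝ) / (2 * D * T))) * (2 * D * T)
      = T * (featVal f.al (centre D lo hi) * (2 * D)) + (f.bx : ℝ) * xc := by field_simp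
  rw [e, ← h]

/-- The resolved form at the centre and `z = zN/zden`: `(β′ + z·m(c, X_c))·(Q·zden) = wAt`, i.e. the form equals
`wAt/(Q·zden)`. -/
theorem kval_centre {D T : ℕ} (hD : 0 < D) (hT : 0 < T) (lo hi : List ℕ) (xc : ℤ) {zden : ℕ} (hzden : 0 < zden)
    (zN : ℤ) (f : KForm) :
    (f.bp : ℝ) + (zN : ℝ) / zden * mval f (centre D lo hi) ((xc : ℝ) / (2 * D * T))
      = (wAt (2 * D * T) T lo hi xc zden zN f : ℝ) / ((2 * D * T : ℕ) * zden) := by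
  have hm := mval_centre hD hT lo hi xc f
  have hQ : (2 * (D : ℝ) * T) ≠ 0 := by positivity
  have hz : (zden : ℝ) ≠ 0 := by exact_mod_cast hzden.ne'
  unfold wAt
  push_cast
  rw [eq_div_iff (by positivity)]
  have : mval f (centre D lo hi) ((xc : ℝ) / (2 * D * T)) = (mcN T lo hi xc f : ℝ) / (2 * D * T) := by
    rw [← hm, mul_div_cancel_right₀ _ hQ]
  rw [this]
  field_simp

/-- **`hAt ∋ H(c, X_c, zN/zden)`** over any list of `Y`-forms. -/
theorem hAt_sound {D T : ℕ} (hD : 0 < D) (hT : 0 < T) {lo hi : List ℕ} {xc : ℤ} {zden : ℕ} (hzden : 0 < zden) {zN : ℤ} :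
    ∀ (F : List KForm) {J : MI}, hAt (2 * D * T) T lo hi xc zden zN F = some J →
      MI.mem SC (valHL F (centre D lo hi) ((xc : ℝ) / (2 * D * T)) ((zN : ℝ) / zden)) J
  | [], J, h => by
    simp only [hAt, Option.some.injEq] at h
    subst h
    simp only [valHL, List.map_nil, List.sum_nil]
    exact_mod_cast MI.mem_ofInt SC 0
  | f :: F, J, h => by
    simp only [hAt] at h
    split at h
    swap
    · simp at h
    rename_i J' I hF hI
    simp only [Option.some.injEq] at h
    subst h
    have IH := hAt_sound hD hT hzden F hF
    have hN : 0 < 2 * D * T * zden := by positivity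
    have hx := xlnxI_sound hN hI
    have e : xlnx (((wAt (2 * D * T) T lo hi xc zden zN f : ℤ) : ℝ) / ((2 * D * T * zden : ℕ) : ℝ))
        = xlnx ((f.bp : ℝ) + (zN : ℝ) / zden * mval f (centre D lo hi) ((xc : ℝ) / (2 * D * T))) := by
      rw [kval_centre hD hT lo hi xc hzden zN f]; push_cast; ring_nf
    rw [e] at hx
    simp only [valHL, List.map_cons, List.sum_cons]
    have := MI.mem_add IH (MI.mem_mulInt hx f.sg)
    convert this using 1
    simp only [valHL]; ring

/-- **`etaAt ∋` the log-form of `H′` at `(c, X_c, zN/zden)`**. -/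
theorem etaAt_sound {D T : ℕ} (hD : 0 < D) (hT : 0 < T) {lo hi : List ℕ} {xc : ℤ} {zden : ℕ} (hzden : 0 < zden) {zN : ℤ} :
    ∀ (F : List KForm) {J : MI}, etaAt (2 * D * T) T lo hi xc zden zN F = some J →
      MI.mem SC (etaL F (centre D lo hi) ((xc : ℝ) / (2 * D * T)) ((zN : ℝ) / zden)) J
  | [], J, h => by
    simp only [etaAt, Option.some.injEq] at h
    subst h
    simp only [etaL, List.map_nil, List.sum_nil]
    exact_mod_cast MI.mem_ofInt SC 0
  | f :: F, J, h => by
    simp only [etaAt] at h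
    by_cases hw : wAt (2 * D * T) T lo hi xc zden zN f = 0
    · simp [hw] at h
    rw [if_neg hw] at h
    split at h
    swap
    · simp at h
    rename_i J' Lw LQ hF hLw hLQ
    simp only [Option.some.injEq] at h
    subst h
    have IH := etaAt_sound hD hT hzden F hF
    have hN : 0 < 2 * D * T * zden := by positivity
    have hNr : (0 : ℝ) < ((2 * D * T * zden : ℕ) : ℝ) := by exact_mod_cast hN
    have hQ : 0 < 2 * D * T := by positivity
    set w := wAt (2 * D * T) T lo hi xc zden zN f with hwdef
    have hwr : (w : ℝ) ≠ 0 := by exact_mod_cast hw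
    -- log|form| = log|w| − log N
    have hform : (f.bp : ℝ) + (zN : ℝ) / zden * mval f (centre D lo hi) ((xc : ℝ) / (2 * D * T))
        = (w : ℝ) / ((2 * D * T * zden : ℕ) : ℝ) := by
      rw [hwdef, kval_centre hD hT lo hi xc hzden zN f]; push_cast; ring_nf
    have hlog : MI.mem SC (Real.log |(f.bp : ℝ) + (zN : ℝ) / zden * mval f (centre D lo hi) ((xc : ℝ) / (2 * D * T))|)
        (Lw.sub LQ) := by
      rw [hform]
      have h1 := MI.mem_logNat2 SC_pos hLw
      have h2 := MI.mem_logNat2 SC_pos hLQ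
      have e : Real.log |(w : ℝ) / ((2 * D * T * zden : ℕ) : ℝ)| = Real.log (w.natAbs : ℕ) - Real.log ((2 * D * T * zden : ℕ) : ℝ) := by
        rw [abs_div, abs_of_pos hNr, Real.log_div (abs_ne_zero.mpr hwr) hNr.ne']
        congr 1
        rw [Nat.cast_natAbs, Int.cast_abs]
      rw [e]
      have : (2 * D * T * zden : ℕ) = 2 * D * T * zden := rfl
      exact MI.mem_sub h1 h2
    have hm : mval f (centre D lo hi) ((xc : ℝ) / (2 * D * T)) = (mcN T lo hi xc f : ℝ) / (2 * D * T) := by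
      rw [← mval_centre hD hT lo hi xc f, mul_div_cancel_right₀ _ (by positivity)]
    have hterm := MI.mem_divNat (MI.mem_mulInt hlog (f.sg * mcN T lo hi xc f)) hQ
    simp only [etaL, List.map_cons, List.sum_cons]
    have := MI.mem_add IH hterm
    convert this using 1
    simp only [etaL]
    rw [hm]; push_cast
    field_simp
    ring

/-- **`aCentre ∋ Σ σ_k xlnx(L_k(c, X_c, 0))`** over any list of (`Y`-free) forms. -/
theorem aCentre_sound {D T : ℕ} (hD : 0 < D) (hT : 0 < T) {lo hi : List ℕ} {xc : ℤ} :
    ∀ (F : List EForm) {J : MI}, (∀ f ∈ F, f.bY = 0) → aCentre (2 * D * T) T lo hi xc F = some J →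
      MI.mem SC (valF F (centre D lo hi) ((xc : ℝ) / (2 * D * T)) 0) J
  | [], J, _, h => by
    simp only [aCentre, Option.some.injEq] at h
    subst h
    simp only [valF, List.map_nil, List.sum_nil]
    exact_mod_cast MI.mem_ofInt SC 0
  | f :: F, J, hY, h => by
    simp only [aCentre] at h
    split at h
    swap
    · simp at h
    rename_i J' I hF hI
    simp only [Option.some.injEq] at h
    subst h
    have IH := aCentre_sound hD hT F (fun f' hf' => hY f' (by simp [hf'])) hF
    have hQ : 0 < 2 * D * T := by positivity
    have hx := xlnxI_sound hQ hI
    have hf0 : f.bY = 0 := hY f (by simp)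
    have e : (((T : ℤ) * (minNum f.al lo hi + maxNum f.al lo hi) + f.bx * xc : ℤ) : ℝ) / ((2 * D * T : ℕ) : ℝ)
        = formVal f (centre D lo hi) ((xc : ℝ) / (2 * D * T)) 0 := by
      have h := minNum_add_maxNum hD lo hi f.al
      unfold formVal
      rw [hf0]; push_cast
      have hQ' : (2 * (D : ℝ) * T) ≠ 0 := by positivity
      field_simp
      nlinarith [h]
    rw [e] at hx
    rw [Envelope.valF_cons]
    have := MI.mem_add IH (MI.mem_mulInt hx f.sg)
    convert this using 1
    ring

end FarSlice

end Summit.KontsevichZagierPeriods.Zeta5Search.Barrier.ConeGamma
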